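import Summits.AtomisticToContinuum.HydrodynamicLimit.Theorems.ImplosionDichotomyPolynomialCompressionLevel3Defs

/-!
# Objects of the level-3 estimate, part B: summed quantities and the polynomial envelope

Definitions file (companion of `…Level3Defs`) for the proof of `stub_logBudgetShadowing` of the crux
`ImplosionDichotomy.PolynomialCompression` (stmt-AtomisticToContinuum-12587), line `log-lipschitz-budget`. Names for
the quantities obtained by summing the one-word objects over all words `(l, m, n)`, the low-order pointwise
magnitudes of `δV`, and the explicit polynomial envelope in which the integrated level-3 inequality is stated:

* `l3e3` — the level-3 energy density `Σₙ Σₘ Σₗ l3e` as a space–time field (its space integral is `shadowE3`);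
  `l3flux3` — the summed fluxes; `l3N3` — the summed weighted magnitudes `Σ l3Nw`;
* `l3m0`, `l3m1` — unweighted pointwise magnitudes of `δV` and of its first derivatives;
* `l3base` — the base `(1 + K + K⁻¹) · R₀(s) · (1 + (T₁ - s)⁻¹)` of the envelope, `R₀(s)` the reference envelope of
  `shadow_reference_envelope`.

Nothing is asserted beyond elementary order facts.
-/

noncomputable section

namespace Summit.AtomisticToContinuum.HydrodynamicLimit.Theorems

open Set MeasureTheory
open Literature.MathematicalPhysics.KineticTheory Literature.Analysis.FunctionSpaces

/-- Level-3 energy density `Σₙ Σₘ Σₗ ½(A (∂ₙ∂ₘ∂ₗδρ)² + ρ ‖∂ₙ∂ₘ∂ₗδu‖² + B (∂ₙ∂ₘ∂ₗδθ)²)` as a space–time field.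
[folklore] -/
def l3e3 (ζ : ℝ → ℝ) (ρ θ ρ₁ θ₁ : ℝ → T3 → ℝ) (u u₁ : ℝ → T3 → V3) : ℝ → T3 → ℝ :=
  fun s y => ∑ n, ∑ m, ∑ l, l3e ζ ρ θ ρ₁ θ₁ u u₁ l m n s y

/-- The `i`-th summed flux of the level-3 energy density at time `t`. [folklore] -/
def l3flux3 (ζ : ℝ → ℝ) (ρ θ ρ₁ θ₁ : ℝ → T3 → ℝ) (u u₁ : ℝ → T3 → V3) (t : ℝ) (i : Fin 3) : T3 → ℝ :=
  fun y => ∑ n, ∑ m, ∑ l, l3flux ζ ρ θ ρ₁ θ₁ u u₁ t l m n i y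

/-- Summed weighted magnitude of the third derivatives of `δV` at `(t, x)`: `Σₙ Σₘ Σₗ l3Nw`. [folklore] -/
def l3N3 (ζ : ℝ → ℝ) (ρ θ ρ₁ θ₁ : ℝ → T3 → ℝ) (u u₁ : ℝ → T3 → V3) (t : ℝ) (x : T3) : ℝ :=
  ∑ n, ∑ m, ∑ l, l3Nw ζ ρ θ ρ₁ θ₁ u u₁ t x l m n

/-- Unweighted pointwise magnitude of `δV` at `(t, x)`: `|δρ| + |δθ| + Σᵢ |δuᵢ|`. [folklore] -/
def l3m0 (ρ θ ρ₁ θ₁ : ℝ → T3 → ℝ) (u u₁ : ℝ → T3 → V3) (t : ℝ) (x : T3) : ℝ :=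
  |ρ t x - ρ₁ t x| + |θ t x - θ₁ t x| + ∑ i, |u t x i - u₁ t x i|

/-- Unweighted pointwise magnitude of the first derivatives of `δV` at `(t, x)`:
`dsize₁ δρ + dsize₁ δθ + Σᵢ dsize₁ δuᵢ`. [folklore] -/
def l3m1 (ρ θ ρ₁ θ₁ : ℝ → T3 → ℝ) (u u₁ : ℝ → T3 → V3) (t : ℝ) (x : T3) : ℝ :=
  Torus.dsize₁ (fun y => ρ t y - ρ₁ t y) x + Torus.dsize₁ (fun y => θ t y - θ₁ t y) x +
    ∑ i, Torus.dsize₁ (fun y => u t y i - u₁ t y i) x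

/-- Base of the level-3 polynomial envelope at time `s`: `(1 + K + K⁻¹) · R₀(s) · (1 + (T₁ - s)⁻¹)` with the
reference envelope `R₀(s) = 576(1+K)(1 + Σ_{n<7} Cpoly n (T₁-s)^{-ppoly n})⁵ (1 + (cl (T₁-s)^{pl})⁻¹)⁵`.
[folklore] -/
def l3base (K cl pl T₁ : ℝ) (Cpoly ppoly : ℕ → ℝ) (s : ℝ) : ℝ :=
  (1 + K + K⁻¹) *
    (576 * (1 + K) * (1 + ∑ n ∈ Finset.range 7, Cpoly n * (T₁ - s) ^ (-ppoly n)) ^ 5 *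
      (1 + (cl * (T₁ - s) ^ pl)⁻¹) ^ 5) * (1 + (T₁ - s)⁻¹)

/-- `l3m0` is nonnegative. [folklore] -/
theorem l3m0_nonneg :
    ∀ {ρ θ ρ₁ θ₁ : ℝ → T3 → ℝ} {u u₁ : ℝ → T3 → V3} {t : ℝ} {x : T3}, 0 ≤ l3m0 ρ θ ρ₁ θ₁ u u₁ t x := by
  intro ρ θ ρ₁ θ₁ u u₁ t x
  unfold l3m0
  exact add_nonneg (add_nonneg (abs_nonneg _) (abs_nonneg _)) (Finset.sum_nonneg fun _ _ => abs_nonneg _)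

/-- `l3m1`, `l3N3` are nonnegative. [folklore] -/
theorem l3m1_N3_nonneg :
    ∀ {ζ : ℝ → ℝ} {ρ θ ρ₁ θ₁ : ℝ → T3 → ℝ} {u u₁ : ℝ → T3 → V3} {t : ℝ} {x : T3},
      0 ≤ l3m1 ρ θ ρ₁ θ₁ u u₁ t x ∧ 0 ≤ l3N3 ζ ρ θ ρ₁ θ₁ u u₁ t x := by
  intro ζ ρ θ ρ₁ θ₁ u u₁ t x
  refine ⟨?_, ?_⟩
  · unfold l3m1
    exact add_nonneg (add_nonneg (Torus.dsize₁_nonneg _ _) (Torus.dsize₁_nonneg _ _))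
      (Finset.sum_nonneg fun _ _ => Torus.dsize₁_nonneg _ _)
  · unfold l3N3
    exact Finset.sum_nonneg fun _ _ => Finset.sum_nonneg fun _ _ => Finset.sum_nonneg fun _ _ => l3Nw_nonneg

end Summit.AtomisticToContinuum.HydrodynamicLimit.Theorems

end
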